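import Literature.NumberTheory.Sieve.PolymathMkEpsIntegrals
import Literature.NumberTheory.Sieve.PolymathBoundedGaps
import HarnessLib

/-!
# Moments of power-sum products over the scaled simplices `(1 ± ε)·R_k` (Polymath 8b §7.2)

Trunk: AntSieve / parity.S13.  Second file of the computational leaf (Theorem 3.13(i)) of the
decomposition of `Literature.NumberTheory.Sieve.frequently_nth_prime_succ_le_add_polymath` (`H₁ ≤ 246`;
D. H. J. Polymath, *Variants of the Selberg sieve, and bounded intervals containing many primes*,
Res. Math. Sci. 1:12 (2014) = arXiv:1407.4897), continuing `PolymathMkEpsIntegrals.lean`.  Polymath 8b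
§7.2 (p. 31): "Instead of computing integrals over the region `R_k` we pass to the regions `(1±ε)R_k` …
Over the region `(1+ε)R_k`, a single change of variables converts the needed integrals into those of the
form in Lemma 7.2 … over the region `(1−ε)R_k` we instead want to work with polynomials of the form
`(1−ε−P₁)^a P_α`.  Since `(1+ε−P₁)^a = (2ε + (1−ε−P₁))^a`, an expansion using the binomial theorem allows
us to convert."  This file PROVES these conversions for the power-sum basis (everything is a theorem):

* `MkEps.psProd_smul` (homogeneity), `MkEps.smul_mem_scaledSimplex_iff`, and the dilation formula
  `MkEps.setIntegral_scaledSimplex_eq`: `∫_{r·R_k} g = r^k ∫_{R_k} g(r·s) ds` for `r > 0`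
  (`Measure.integral_comp_smul`; `scaledSimplex` is the one of `PolymathBoundedGaps.lean`);
* `MkEps.integral_scaledSimplex_psMoment`: `∫_{r·R_k} (r − P₁)^a ∏ p^c = r^{k+a+deg} a! S_k(c)/(k+a+deg)!`
  (the `I(F)`-side moments over `(1+ε)·R_k`);
* `MkEps.integral_simplex_affine_psMoment`: `∫_{R_n} (α + β(1−P₁))^E ∏ p^c = ∑_B C(E,B) α^{E−B} β^B B! S_n(c)/(n+B+deg)!`;
* `MkEps.integral_scaledSimplex_shifted_psMoment`:
  `∫_{ρ·R_n} (r − P₁)^E ∏ p^c = ρ^{n+deg} ∑_B C(E,B)(r−ρ)^{E−B} ρ^B B! S_n(c)/(n+B+deg)!`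
  (the `J`-side moments over `(1−ε)·R_{k−1}` with the weight `(1+ε−P₁)^E`, `r − ρ = 2ε`).

Not here (next files): the inner `t_i`-integral of `J_{i,1−ε}` and `I`, `J` of power-sum test functions,
the evaluator and the certificate.

## References

* D. H. J. Polymath, *Variants of the Selberg sieve, and bounded intervals containing many primes*,
  Res. Math. Sci. 1 (2014), Art. 12; arXiv:1407.4897, §7.2 (p. 31), Lemma 7.2. [Polymath8b2014]
-/

open MeasureTheory Set Filter Finset intervalIntegral
open scoped BigOperators

noncomputable section

namespace Literature.NumberTheory.Sieve

namespace MkEps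

variable {P : ℕ}

/-- Homogeneity: `psProd v c (r • s) = r^{deg} psProd v c s`. [folklore] -/
theorem psProd_smul {k : ℕ} (v : Fin P → ℕ) (c : Fin P → ℕ) (r : ℝ) (s : Fin k → ℝ) :
    psProd v c (r • s) = r ^ psDeg v c * psProd v c s := by
  unfold psProd psDeg
  rw [← Finset.prod_pow_eq_pow_sum, ← Finset.prod_mul_distrib]
  refine Finset.prod_congr rfl fun p _ => ?_
  have h : ∑ l, (r • s) l ^ v p = r ^ v p * ∑ l, s l ^ v p := by
    rw [Finset.mul_sum]
    exact Finset.sum_congr rfl fun l _ => by simp [Pi.smul_apply, smul_eq_mul, mul_pow]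
  rw [h, mul_pow, ← pow_mul]

/-- Membership in the scaled simplex under dilation (`r > 0`): `r • s ∈ r·R_k ↔ s ∈ R_k`. [folklore] -/
theorem smul_mem_scaledSimplex_iff {k : ℕ} {r : ℝ} (hr : 0 < r) (s : Fin k → ℝ) :
    r • s ∈ scaledSimplex k r ↔ s ∈ maynardSimplex k := by
  simp only [scaledSimplex, maynardSimplex, Set.mem_setOf_eq, Pi.smul_apply, smul_eq_mul,
    ← Finset.mul_sum]
  constructor
  · rintro ⟨h1, h2⟩
    exact ⟨fun i => (mul_nonneg_iff_of_pos_left hr).1 (h1 i), (mul_le_iff_le_one_right hr).1 h2⟩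
  · rintro ⟨h1, h2⟩
    exact ⟨fun i => mul_nonneg hr.le (h1 i), (mul_le_iff_le_one_right hr).2 h2⟩

/-- **Dilation of the simplex**: for `r > 0` and any `g`,
`∫_{r·R_k} g = r^k ∫_{R_k} g(r s) ds` (the "single change of variables" of Polymath 8b §7.2).
[cite: Polymath8b2014, §7.2] -/
theorem setIntegral_scaledSimplex_eq {k : ℕ} {r : ℝ} (hr : 0 < r) (g : (Fin k → ℝ) → ℝ) :
    ∫ t in scaledSimplex k r, g t = r ^ k * ∫ s in maynardSimplex k, g (r • s) := by
  have hmeas : MeasurableSet (scaledSimplex k r) := measurableSet_scaledSimplex k r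
  have hmeas1 : MeasurableSet (maynardSimplex k) := by
    rw [← scaledSimplex_one]; exact measurableSet_scaledSimplex k 1
  rw [← MeasureTheory.integral_indicator hmeas, ← MeasureTheory.integral_indicator hmeas1]
  have hind : ∀ s : Fin k → ℝ, (scaledSimplex k r).indicator g (r • s) =
      (maynardSimplex k).indicator (fun s => g (r • s)) s := by
    intro s
    by_cases hs : s ∈ maynardSimplex k
    · rw [Set.indicator_of_mem hs, Set.indicator_of_mem ((smul_mem_scaledSimplex_iff hr s).2 hs)]
    · rw [Set.indicator_of_notMem hs, Set.indicator_of_notMem (fun h => hs ((smul_mem_scaledSimplex_iff hr s).1 h))]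
  have h := Measure.integral_comp_smul (volume : Measure (Fin k → ℝ)) ((scaledSimplex k r).indicator g) r
  rw [Module.finrank_fin_fun] at h
  simp_rw [hind] at h
  rw [h, smul_eq_mul, abs_of_pos (inv_pos.2 (pow_pos hr k)), ← mul_assoc, mul_inv_cancel₀ (pow_pos hr k).ne',
    one_mul]

/-- **Moments over the enlarged simplex** (Polymath 8b §7.2, "Over the region `(1+ε)·R_k`, a single change
of variables converts the needed integrals into those of the form in Lemma 7.2"): for `r > 0`,
`∫_{r·R_k} (r − P₁)^a ∏_p p_{v_p}^{c_p} = r^{k + a + deg} · a! S_k(c)/(k + a + deg)!`. [cite: Polymath8b2014, §7.2] -/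
theorem integral_scaledSimplex_psMoment {k : ℕ} (v : Fin P → ℕ) {r : ℝ} (hr : 0 < r) (a : ℕ)
    (c : Fin P → ℕ) :
    ∫ t in scaledSimplex k r, (r - ∑ i, t i) ^ a * psProd v c t =
      r ^ (k + a + psDeg v c) * (((a.factorial * dSgen v k c : ℕ) : ℝ) / (k + a + psDeg v c).factorial) := by
  rw [setIntegral_scaledSimplex_eq hr]
  have h : ∀ s : Fin k → ℝ, (r - ∑ i, (r • s) i) ^ a * psProd v c (r • s) =
      r ^ (a + psDeg v c) * ((1 - ∑ i, s i) ^ a * psProd v c s) := by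
    intro s
    rw [psProd_smul]
    have : r - ∑ i, (r • s) i = r * (1 - ∑ i, s i) := by
      simp only [Pi.smul_apply, smul_eq_mul, ← Finset.mul_sum]; ring
    rw [this, mul_pow, pow_add]; ring
  simp_rw [h]
  rw [MeasureTheory.integral_const_mul, integral_simplex_psMoment, pow_add, pow_add]
  ring

/-- **Moments with an affine weight** `(α + β(1 − P₁))^E` (the re-expansion
`(1+ε−P₁)^a = (2ε + (1−ε−P₁))^a` of Polymath 8b §7.2, after rescaling):
`∫_{R_n} (α + β(1−P₁))^E ∏ p^c = ∑_{B ≤ E} C(E,B) α^{E−B} β^B · B! S_n(c)/(n + B + deg)!`.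
[cite: Polymath8b2014, §7.2] -/
theorem integral_simplex_affine_psMoment {n : ℕ} (v : Fin P → ℕ) (α β : ℝ) (E : ℕ) (c : Fin P → ℕ) :
    ∫ s in maynardSimplex n, (α + β * (1 - ∑ i, s i)) ^ E * psProd v c s =
      ∑ B ∈ Finset.range (E + 1), (E.choose B : ℝ) * α ^ (E - B) * β ^ B *
        (((B.factorial * dSgen v n c : ℕ) : ℝ) / (n + B + psDeg v c).factorial) := by
  have h : ∀ s : Fin n → ℝ, (α + β * (1 - ∑ i, s i)) ^ E * psProd v c s =
      ∑ B ∈ Finset.range (E + 1), ((E.choose B : ℝ) * α ^ (E - B) * β ^ B) *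
        ((1 - ∑ i, s i) ^ B * psProd v c s) := by
    intro s
    rw [add_comm, add_pow, Finset.sum_mul]
    refine Finset.sum_congr rfl fun B _ => ?_
    rw [mul_pow]; ring
  simp_rw [h]
  have hint : ∀ B ∈ Finset.range (E + 1), Integrable (fun s : Fin n → ℝ =>
      ((E.choose B : ℝ) * α ^ (E - B) * β ^ B) * ((1 - ∑ i, s i) ^ B * psProd v c s))
      (volume.restrict (maynardSimplex n)) := by
    intro B _
    have hc : Continuous fun s : Fin n → ℝ =>
        ((E.choose B : ℝ) * α ^ (E - B) * β ^ B) * ((1 - ∑ i, s i) ^ B * psProd v c s) :=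
      continuous_const.mul ((by fun_prop : Continuous fun s : Fin n → ℝ => (1 - ∑ i, s i) ^ B).mul
        (continuous_psProd v c))
    exact hc.continuousOn.integrableOn_compact (isCompact_maynardSimplex _)
  rw [integral_finsetSum _ hint]
  refine Finset.sum_congr rfl fun B _ => ?_
  rw [MeasureTheory.integral_const_mul, integral_simplex_psMoment]

/-- **Moments over the shrunken simplex with the enlarged weight** (the `J`-side integrals of §7.2):
for `ρ > 0` and any `r`,
`∫_{ρ·R_n} (r − P₁)^E ∏ p^c = ρ^{n + deg} ∑_{B ≤ E} C(E,B) (r − ρ)^{E−B} ρ^B · B! S_n(c)/(n + B + deg)!`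
(with `ρ = 1 − ε`, `r = 1 + ε`: `r − ρ = 2ε`). [cite: Polymath8b2014, §7.2] -/
theorem integral_scaledSimplex_shifted_psMoment {n : ℕ} (v : Fin P → ℕ) {ρ : ℝ} (hρ : 0 < ρ) (r : ℝ)
    (E : ℕ) (c : Fin P → ℕ) :
    ∫ t in scaledSimplex n ρ, (r - ∑ i, t i) ^ E * psProd v c t =
      ρ ^ (n + psDeg v c) * ∑ B ∈ Finset.range (E + 1), (E.choose B : ℝ) * (r - ρ) ^ (E - B) * ρ ^ B *
        (((B.factorial * dSgen v n c : ℕ) : ℝ) / (n + B + psDeg v c).factorial) := by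
  rw [setIntegral_scaledSimplex_eq hρ]
  have h : ∀ s : Fin n → ℝ, (r - ∑ i, (ρ • s) i) ^ E * psProd v c (ρ • s) =
      ρ ^ psDeg v c * (((r - ρ) + ρ * (1 - ∑ i, s i)) ^ E * psProd v c s) := by
    intro s
    rw [psProd_smul]
    have : r - ∑ i, (ρ • s) i = (r - ρ) + ρ * (1 - ∑ i, s i) := by
      simp only [Pi.smul_apply, smul_eq_mul, ← Finset.mul_sum]; ring
    rw [this]; ring
  simp_rw [h]
  rw [MeasureTheory.integral_const_mul, integral_simplex_affine_psMoment, pow_add]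
  ring

end MkEps

end Literature.NumberTheory.Sieve
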